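import Summits.ValiantsHypothesis.ValiantsHypothesis.Theorems.KPlusLogSqLawTridiagonalRealStaticUnitSixChambers
import Summits.ValiantsHypothesis.ValiantsHypothesis.Theorems.KPlusLogSqLawStaticTridiagonalPivotLogConcave

/-!
# Route «KPlusLogSqLaw», crux `WeakLifting` (stmt-ValiantsHypothesis-19561) — REAL side of the tridiagonal sector:
# the UNIT-COEFFICIENT sub-sector at size `6` — the CONCORDANT-SIDE TWO LAW (log-convexity of the secular factors)

HONEST FRAMING.  Helper theorems (`--supports stmt-ValiantsHypothesis-19561 --as helper`), seat val-sym-lift-p1 (g17), cell `pub-symmetroid`,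
2026-08-28; third file on the row `m = 6` of the unit-coefficient sub-sector of the α register (after `…UnitSixChambers` — two-triangle gauge
`D₆ = x^E((1 − b₀ − b₁)(1 − b₃ − b₄) − b₂(1 − b₀)(1 − b₄))`, `b_t = x^{L_t}`, `L_t = 2f_t − d_t − d_{t+1}` — and `…UnitSixChambersTwo`).
On the CONCORDANT side of `x = 1` — the side where both OUTER links dominate their vertices, `b₀ > 1` and `b₄ > 1`, i.e. `(1, ∞)` when
`L₀, L₄ > 0` and `(0, 1)` when `L₀, L₄ < 0` — the root equation reads `(1 + b₁/(b₀ − 1))·(1 + b₃/(b₄ − 1)) = b₂`, and each secular factor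
`1 + x^{L₁}/(x^{L₀} − 1) = 1 + Σ_{n ≥ 1} x^{L₁ − nL₀}` is STRICTLY LOG-CONVEX in `ln x`, while `b₂ = x^{L₂}` is log-linear.  Proved here, for ALL
exponent data (no sign condition on `L₁, L₂, L₃`):
* `secular_factor_logConvex` — for `1 < x < z`, weights `p, q > 0`, `p + q = 1` and `y = x^p z^q`:
  `x ↦ x^{L₁}/(x^{L₀} − 1)` satisfies `K(y) < K(x)^p K(z)^q` (weighted AM–GM on `1 − y^{−L₀} = 1 − (x^{−L₀})^p (z^{−L₀})^q`, strict because
  `x ≠ z`), hence `1 + K(y) < (1 + K(x))^p (1 + K(z))^q` (two-term Hölder, the tree's `DefiniteInterpolation.holder_two`, lift-p2 g9);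
* `unit_six_concordant_no_three` — three roots `1 < x < y < z` of the root equation are impossible when `L₀, L₄ > 0`;
* **CONCORDANT-SIDE TWO LAW** (`card_posRoots_gt_one_unit_six_le_two`, `card_posRoots_lt_one_unit_six_le_two`): `L₀ > 0 ∧ L₄ > 0` ⇒ at most TWO
  determinant zeros in `(1, ∞)`; `L₀ < 0 ∧ L₄ < 0` ⇒ at most TWO in `(0, 1)` (by `x ↦ 1/x`).
So for the six sign classes with `sign L₀ = sign L₄` one side of `1` carries ≤ 2 zeros by a convexity mechanism (located census, memo
U6-CHAMBERS-liftp1g17.md §3: that side carries ≤ 1 in all sampled designs; the other side ≤ 3).  Nothing here is an upper law for the register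
(α NO MOVER); nothing bears on `WeakLifting` / `TropicalB` (stmt-19771) in their windows, Conjecture B, the Door-A registers, `MatrixDescartes`
(stmt-18050) or VP ≠ VNP.
[this seat; folklore: weighted AM–GM / Hölder, log-convexity of positive exponential sums]
-/

-- `Summit.ValiantsHypothesis.ValiantsHypothesis.…` repeats a component by the D-0017 layout (single-conjunct summit); the name is mandated.
set_option linter.dupNamespace false
set_option autoImplicit false

namespace Summit.ValiantsHypothesis.ValiantsHypothesis.Theorems.KPlusLogSqLaw
namespace StaticTridiagonalRealUnit

open Polynomial Finset
open Summit.ValiantsHypothesis.ValiantsHypothesis.Theorems.KPlusLogSqLaw.StaticTridiagonalRealPotential (pathDet)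
open Summit.ValiantsHypothesis.ValiantsHypothesis.Theorems.KPlusLogSqLaw.DefiniteInterpolation (holder_two exists_rpow_interp)

variable (d : ℕ → ℕ) (f : ℕ → ℕ)

/-! ### Geometric interpolation of integer powers -/

/-- integer powers interpolate geometrically: `(x^p z^q)^L = (x^L)^p (z^L)^q` (`x, z > 0`, real weights `p, q`, integer `L`). [folklore] -/
theorem zpow_interp {x z : ℝ} (hx : 0 < x) (hz : 0 < z) (p q : ℝ) (L : ℤ) :
    (x ^ p * z ^ q) ^ L = (x ^ L) ^ p * (z ^ L) ^ q := by
  rw [← Real.rpow_intCast (x ^ p * z ^ q) L, Real.mul_rpow (Real.rpow_nonneg hx.le p) (Real.rpow_nonneg hz.le q),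
    ← Real.rpow_mul hx.le, ← Real.rpow_mul hz.le, mul_comm p, mul_comm q, Real.rpow_mul hx.le, Real.rpow_mul hz.le,
    Real.rpow_intCast, Real.rpow_intCast]

/-! ### Strict log-convexity of the secular factor `x^{L₁}/(x^{L₀} − 1)` on `(1, ∞)` -/

/-- **weighted AM–GM, complementary form (strict)**: for `a ≠ b` in `(0, 1)` and weights `p, q > 0`, `p + q = 1`,
`(1 − a)^p (1 − b)^q < 1 − a^p b^q`. [folklore] -/
theorem compl_geom_mean_lt {a b p q : ℝ} (ha0 : 0 < a) (ha1 : a < 1) (hb0 : 0 < b) (hb1 : b < 1) (hab : a ≠ b)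
    (hp : 0 < p) (hq : 0 < q) (hpq : p + q = 1) : (1 - a) ^ p * (1 - b) ^ q < 1 - a ^ p * b ^ q := by
  have h1 : (1 - a) ^ p * (1 - b) ^ q ≤ p * (1 - a) + q * (1 - b) :=
    Real.geom_mean_le_arith_mean2_weighted hp.le hq.le (by linarith) (by linarith) hpq
  have h2 : a ^ p * b ^ q ≤ p * a + q * b := Real.geom_mean_le_arith_mean2_weighted hp.le hq.le ha0.le hb0.le hpq
  have h3 : a ^ p * b ^ q ≠ p * a + q * b := fun h =>
    hab ((Real.geom_mean_eq_arith_mean2_weighted_iff_of_pos hp hq ha0.le hb0.le hpq).1 h)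
  have h4 : a ^ p * b ^ q < p * a + q * b := lt_of_le_of_ne h2 h3
  nlinarith

/-- **the secular factor is strictly log-convex in `ln x`**: for `L₀ > 0`, `1 < x < z`, weights `p, q > 0` with `p + q = 1` and
`y = x^p z^q`, `K(y) < K(x)^p · K(z)^q` where `K(w) = w^{L₁}/(w^{L₀} − 1)` (`= w^{L₁−L₀}/(1 − w^{−L₀}) = Σ_{n≥1} w^{L₁ − nL₀}`). [this file] -/
theorem secular_factor_logConvex (L₀ L₁ : ℤ) (h0 : 0 < L₀) {x z p q : ℝ} (hx : 1 < x) (hxz : x < z)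
    (hp : 0 < p) (hq : 0 < q) (hpq : p + q = 1) :
    (x ^ p * z ^ q) ^ L₁ / ((x ^ p * z ^ q) ^ L₀ - 1) <
      (x ^ L₁ / (x ^ L₀ - 1)) ^ p * (z ^ L₁ / (z ^ L₀ - 1)) ^ q := by
  have hx0 : 0 < x := one_pos.trans hx
  have hz : 1 < z := hx.trans hxz
  have hz0 : 0 < z := hx0.trans hxz
  set y := x ^ p * z ^ q with hy
  have hy0 : 0 < y := mul_pos (Real.rpow_pos_of_pos hx0 p) (Real.rpow_pos_of_pos hz0 q)
  -- rewrite every factor as `w^{L₁−L₀}/(1 − w^{−L₀})`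
  have key : ∀ w : ℝ, 0 < w → w ^ L₁ / (w ^ L₀ - 1) = w ^ (L₁ - L₀) / (1 - w ^ (-L₀)) := by
    intro w hw
    have hwL : w ^ L₀ ≠ 0 := (zpow_pos hw _).ne'
    rw [zpow_sub₀ hw.ne', zpow_neg, div_div, mul_sub, mul_one, mul_inv_cancel₀ hwL]
  rw [key y hy0, key x hx0, key z hz0]
  -- the numerator interpolates exactly, the denominator strictly super-interpolates
  set a := x ^ (-L₀) with ha
  set b := z ^ (-L₀) with hb
  have ha0 : 0 < a := zpow_pos hx0 _
  have hb0 : 0 < b := zpow_pos hz0 _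
  have ha1 : a < 1 := zpow_lt_one_of_neg₀ hx (by omega)
  have hb1 : b < 1 := zpow_lt_one_of_neg₀ hz (by omega)
  have hab : a ≠ b := by
    intro h
    have := zpow_lt_zpow_left_of_neg (show -L₀ < 0 by omega) hx0 hxz
    rw [← ha, ← hb, h] at this
    exact lt_irrefl _ this
  have num : y ^ (L₁ - L₀) = (x ^ (L₁ - L₀)) ^ p * (z ^ (L₁ - L₀)) ^ q := zpow_interp hx0 hz0 p q _
  have den : y ^ (-L₀) = a ^ p * b ^ q := zpow_interp hx0 hz0 p q _
  have hden : (1 - a) ^ p * (1 - b) ^ q < 1 - y ^ (-L₀) := by rw [den]; exact compl_geom_mean_lt ha0 ha1 hb0 hb1 hab hp hq hpq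
  have hpos : 0 < (1 - a) ^ p * (1 - b) ^ q :=
    mul_pos (Real.rpow_pos_of_pos (by linarith) p) (Real.rpow_pos_of_pos (by linarith) q)
  have hnum : 0 < (x ^ (L₁ - L₀)) ^ p * (z ^ (L₁ - L₀)) ^ q :=
    mul_pos (Real.rpow_pos_of_pos (zpow_pos hx0 _) p) (Real.rpow_pos_of_pos (zpow_pos hz0 _) q)
  rw [Real.div_rpow (zpow_pos hx0 _).le (by linarith), Real.div_rpow (zpow_pos hz0 _).le (by linarith),
    div_mul_div_comm, num]
  exact div_lt_div_of_pos_left hnum hpos hden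

/-- consequently `1 + K` is strictly log-convex too: `1 + K(y) < (1 + K(x))^p (1 + K(z))^q` (two-term Hölder). [this file] -/
theorem one_add_secular_factor_logConvex (L₀ L₁ : ℤ) (h0 : 0 < L₀) {x z p q : ℝ} (hx : 1 < x) (hxz : x < z)
    (hp : 0 < p) (hq : 0 < q) (hpq : p + q = 1) :
    1 + (x ^ p * z ^ q) ^ L₁ / ((x ^ p * z ^ q) ^ L₀ - 1) <
      (1 + x ^ L₁ / (x ^ L₀ - 1)) ^ p * (1 + z ^ L₁ / (z ^ L₀ - 1)) ^ q := by
  have hx0 : 0 < x := one_pos.trans hx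
  have hz : 1 < z := hx.trans hxz
  have hz0 : 0 < z := hx0.trans hxz
  have kx : 0 ≤ x ^ L₁ / (x ^ L₀ - 1) := (div_pos (zpow_pos hx0 _) (sub_pos.2 (one_lt_zpow₀ hx h0))).le
  have kz : 0 ≤ z ^ L₁ / (z ^ L₀ - 1) := (div_pos (zpow_pos hz0 _) (sub_pos.2 (one_lt_zpow₀ hz h0))).le
  have h1 := secular_factor_logConvex L₀ L₁ h0 hx hxz hp hq hpq
  have h2 := holder_two zero_le_one kx zero_le_one kz hp hq hpq
  rw [Real.one_rpow, Real.one_rpow, one_mul] at h2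
  linarith

/-! ### No three zeros on the concordant side -/

/-- the root equation on `(1, ∞)` in secular form: `(1 + b₁/(b₀ − 1))(1 + b₃/(b₄ − 1)) = b₂` (for `L₀, L₄ > 0`). [this file] -/
theorem unit_six_secular_gt_one (L₀ L₁ L₂ L₃ L₄ : ℤ) (h0 : 0 < L₀) (h4 : 0 < L₄) {x : ℝ} (hx : 1 < x)
    (hr : (1 - x ^ L₀ - x ^ L₁) * (1 - x ^ L₃ - x ^ L₄) = x ^ L₂ * (1 - x ^ L₀) * (1 - x ^ L₄)) :
    (1 + x ^ L₁ / (x ^ L₀ - 1)) * (1 + x ^ L₃ / (x ^ L₄ - 1)) = x ^ L₂ := by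
  have c : 0 < x ^ L₀ - 1 := sub_pos.2 (one_lt_zpow₀ hx h0)
  have d : 0 < x ^ L₄ - 1 := sub_pos.2 (one_lt_zpow₀ hx h4)
  field_simp
  linarith

/-- **no three zeros on the concordant side**: for `L₀, L₄ > 0` three solutions `1 < x < y < z` of the root equation are impossible
(the left side of the secular form is strictly log-convex in `ln x`, the right side `x^{L₂}` is log-linear). [this file] -/
theorem unit_six_concordant_no_three (L₀ L₁ L₂ L₃ L₄ : ℤ) (h0 : 0 < L₀) (h4 : 0 < L₄)
    {x y z : ℝ} (hx : 1 < x) (hxy : x < y) (hyz : y < z)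
    (hxr : (1 - x ^ L₀ - x ^ L₁) * (1 - x ^ L₃ - x ^ L₄) = x ^ L₂ * (1 - x ^ L₀) * (1 - x ^ L₄))
    (hyr : (1 - y ^ L₀ - y ^ L₁) * (1 - y ^ L₃ - y ^ L₄) = y ^ L₂ * (1 - y ^ L₀) * (1 - y ^ L₄))
    (hzr : (1 - z ^ L₀ - z ^ L₁) * (1 - z ^ L₃ - z ^ L₄) = z ^ L₂ * (1 - z ^ L₀) * (1 - z ^ L₄)) : False := by
  have hx0 : 0 < x := one_pos.trans hx
  have hy : 1 < y := hx.trans hxy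
  have hz : 1 < z := hy.trans hyz
  have hz0 : 0 < z := hx0.trans (hxy.trans hyz)
  obtain ⟨p, q, hp, hq, hpq, hyw⟩ := exists_rpow_interp hx0 hxy hyz
  have fx := unit_six_secular_gt_one L₀ L₁ L₂ L₃ L₄ h0 h4 hx hxr
  have fy := unit_six_secular_gt_one L₀ L₁ L₂ L₃ L₄ h0 h4 hy hyr
  have fz := unit_six_secular_gt_one L₀ L₁ L₂ L₃ L₄ h0 h4 hz hzr
  have hxz : x < z := hxy.trans hyz
  have g0 := one_add_secular_factor_logConvex L₀ L₁ h0 hx hxz hp hq hpq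
  have g4 := one_add_secular_factor_logConvex L₄ L₃ h4 hx hxz hp hq hpq
  rw [hyw] at g0 g4
  -- positivity of the four factors at `x` and `z`
  have cx : 0 < x ^ L₀ - 1 := sub_pos.2 (one_lt_zpow₀ hx h0)
  have dx : 0 < x ^ L₄ - 1 := sub_pos.2 (one_lt_zpow₀ hx h4)
  have cz : 0 < z ^ L₀ - 1 := sub_pos.2 (one_lt_zpow₀ hz h0)
  have dz : 0 < z ^ L₄ - 1 := sub_pos.2 (one_lt_zpow₀ hz h4)
  have ax : 0 < 1 + x ^ L₁ / (x ^ L₀ - 1) := by positivity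
  have bx : 0 < 1 + x ^ L₃ / (x ^ L₄ - 1) := by positivity
  have az : 0 < 1 + z ^ L₁ / (z ^ L₀ - 1) := by positivity
  have bz : 0 < 1 + z ^ L₃ / (z ^ L₄ - 1) := by positivity
  have cy : 0 < y ^ L₀ - 1 := sub_pos.2 (one_lt_zpow₀ hy h0)
  have dy : 0 < y ^ L₄ - 1 := sub_pos.2 (one_lt_zpow₀ hy h4)
  have ay : 0 < 1 + y ^ L₁ / (y ^ L₀ - 1) := by positivity
  -- multiply the two strict log-convexity inequalities
  have prod : (1 + y ^ L₁ / (y ^ L₀ - 1)) * (1 + y ^ L₃ / (y ^ L₄ - 1)) <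
      ((1 + x ^ L₁ / (x ^ L₀ - 1)) ^ p * (1 + z ^ L₁ / (z ^ L₀ - 1)) ^ q) *
        ((1 + x ^ L₃ / (x ^ L₄ - 1)) ^ p * (1 + z ^ L₃ / (z ^ L₄ - 1)) ^ q) :=
    mul_lt_mul'' g0 g4 ay.le (by positivity)
  have rearr : ((1 + x ^ L₁ / (x ^ L₀ - 1)) ^ p * (1 + z ^ L₁ / (z ^ L₀ - 1)) ^ q) *
        ((1 + x ^ L₃ / (x ^ L₄ - 1)) ^ p * (1 + z ^ L₃ / (z ^ L₄ - 1)) ^ q) =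
      ((1 + x ^ L₁ / (x ^ L₀ - 1)) * (1 + x ^ L₃ / (x ^ L₄ - 1))) ^ p *
        ((1 + z ^ L₁ / (z ^ L₀ - 1)) * (1 + z ^ L₃ / (z ^ L₄ - 1))) ^ q := by
    rw [Real.mul_rpow ax.le bx.le, Real.mul_rpow az.le bz.le]; ring
  rw [rearr, fx, fy, fz, ← zpow_interp hx0 hz0 p q L₂, hyw] at prod
  exact lt_irrefl _ prod

/-! ### The concordant-side two law -/

/-- **CONCORDANT-SIDE TWO LAW (above `1`).**  If both outer slopes are positive (`L₀ > 0`, `L₄ > 0`; any `L₁, L₂, L₃`), the unit `6 × 6` design has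
at most TWO determinant zeros in `(1, ∞)`. [this file] -/
theorem card_posRoots_gt_one_unit_six_le_two (h0 : 0 < (2 * f 0 : ℤ) - d 0 - d 1) (h4 : 0 < (2 * f 4 : ℤ) - d 4 - d 5) :
    ((pathDet (fun _ => (1 : ℝ)) d (fun _ => (1 : ℝ)) f 6).roots.toFinset.filter (fun x => 1 < x)).card ≤ 2 := by
  set S := (pathDet (fun _ => (1 : ℝ)) d (fun _ => (1 : ℝ)) f 6).roots.toFinset.filter (fun x => 1 < x) with hS
  have mem : ∀ x, x ∈ S → 1 < x ∧ (1 - x ^ ((2 * f 0 : ℤ) - d 0 - d 1) - x ^ ((2 * f 1 : ℤ) - d 1 - d 2)) *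
      (1 - x ^ ((2 * f 3 : ℤ) - d 3 - d 4) - x ^ ((2 * f 4 : ℤ) - d 4 - d 5)) =
      x ^ ((2 * f 2 : ℤ) - d 2 - d 3) * (1 - x ^ ((2 * f 0 : ℤ) - d 0 - d 1)) * (1 - x ^ ((2 * f 4 : ℤ) - d 4 - d 5)) := by
    intro x hx
    simp only [hS, Finset.mem_filter, Multiset.mem_toFinset, mem_roots', IsRoot.def] at hx
    exact ⟨hx.2, unit_six_root_eq d f (one_pos.trans hx.2) hx.1.2⟩
  by_contra h3
  obtain ⟨a, ha, b, hb, c, hc, hab, hac, hbc⟩ := Finset.two_lt_card.1 (show 2 < S.card by omega)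
  obtain ⟨ha1, har⟩ := mem a ha
  obtain ⟨hb1, hbr⟩ := mem b hb
  obtain ⟨hc1, hcr⟩ := mem c hc
  rcases hab.lt_or_gt with hab | hba
  · rcases hbc.lt_or_gt with hbc | hcb
    · exact unit_six_concordant_no_three _ _ _ _ _ h0 h4 ha1 hab hbc har hbr hcr
    · rcases hac.lt_or_gt with hac | hca
      · exact unit_six_concordant_no_three _ _ _ _ _ h0 h4 ha1 hac hcb har hcr hbr
      · exact unit_six_concordant_no_three _ _ _ _ _ h0 h4 hc1 hca hab hcr har hbr
  · rcases hbc.lt_or_gt with hbc | hcb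
    · rcases hac.lt_or_gt with hac | hca
      · exact unit_six_concordant_no_three _ _ _ _ _ h0 h4 hb1 hba hac hbr har hcr
      · exact unit_six_concordant_no_three _ _ _ _ _ h0 h4 hb1 hbc hca hbr hcr har
    · exact unit_six_concordant_no_three _ _ _ _ _ h0 h4 hc1 hcb hba hcr hbr har

/-! ### The mirror law below `1` (outer slopes negative), by `x ↦ 1/x` -/

/-- no three zeros in `(0, 1)` when `L₀, L₄ < 0` (transport of `unit_six_concordant_no_three` along `x ↦ x⁻¹`, slopes negated). [this file] -/
theorem unit_six_concordant_no_three' (L₀ L₁ L₂ L₃ L₄ : ℤ) (h0 : L₀ < 0) (h4 : L₄ < 0)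
    {x y z : ℝ} (hx : 0 < x) (hxy : x < y) (hyz : y < z) (hz : z < 1)
    (hxr : (1 - x ^ L₀ - x ^ L₁) * (1 - x ^ L₃ - x ^ L₄) = x ^ L₂ * (1 - x ^ L₀) * (1 - x ^ L₄))
    (hyr : (1 - y ^ L₀ - y ^ L₁) * (1 - y ^ L₃ - y ^ L₄) = y ^ L₂ * (1 - y ^ L₀) * (1 - y ^ L₄))
    (hzr : (1 - z ^ L₀ - z ^ L₁) * (1 - z ^ L₃ - z ^ L₄) = z ^ L₂ * (1 - z ^ L₀) * (1 - z ^ L₄)) : False := by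
  have hy0 : 0 < y := hx.trans hxy
  have hz0 : 0 < z := hy0.trans hyz
  refine unit_six_concordant_no_three (-L₀) (-L₁) (-L₂) (-L₃) (-L₄) (by omega) (by omega)
    (x := z⁻¹) (y := y⁻¹) (z := x⁻¹) ((one_lt_inv₀ hz0).2 hz) ((inv_lt_inv₀ hz0 hy0).2 hyz) ((inv_lt_inv₀ hy0 hx).2 hxy)
    ?_ ?_ ?_
  · simp only [unit_six_inv_aux]; exact hzr
  · simp only [unit_six_inv_aux]; exact hyr
  · simp only [unit_six_inv_aux]; exact hxr

/-- **CONCORDANT-SIDE TWO LAW (below `1`).**  If both outer slopes are negative (`L₀ < 0`, `L₄ < 0`; any `L₁, L₂, L₃`), the unit `6 × 6` design has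
at most TWO determinant zeros in `(0, 1)`. [this file] -/
theorem card_posRoots_lt_one_unit_six_le_two (h0 : (2 * f 0 : ℤ) - d 0 - d 1 < 0) (h4 : (2 * f 4 : ℤ) - d 4 - d 5 < 0) :
    ((pathDet (fun _ => (1 : ℝ)) d (fun _ => (1 : ℝ)) f 6).roots.toFinset.filter (fun x => 0 < x ∧ x < 1)).card ≤ 2 := by
  set S := (pathDet (fun _ => (1 : ℝ)) d (fun _ => (1 : ℝ)) f 6).roots.toFinset.filter (fun x => 0 < x ∧ x < 1) with hS
  have mem : ∀ x, x ∈ S → (0 < x ∧ x < 1) ∧ (1 - x ^ ((2 * f 0 : ℤ) - d 0 - d 1) - x ^ ((2 * f 1 : ℤ) - d 1 - d 2)) *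
      (1 - x ^ ((2 * f 3 : ℤ) - d 3 - d 4) - x ^ ((2 * f 4 : ℤ) - d 4 - d 5)) =
      x ^ ((2 * f 2 : ℤ) - d 2 - d 3) * (1 - x ^ ((2 * f 0 : ℤ) - d 0 - d 1)) * (1 - x ^ ((2 * f 4 : ℤ) - d 4 - d 5)) := by
    intro x hx
    simp only [hS, Finset.mem_filter, Multiset.mem_toFinset, mem_roots', IsRoot.def] at hx
    exact ⟨hx.2, unit_six_root_eq d f hx.2.1 hx.1.2⟩
  by_contra h3
  obtain ⟨a, ha, b, hb, c, hc, hab, hac, hbc⟩ := Finset.two_lt_card.1 (show 2 < S.card by omega)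
  obtain ⟨⟨ha0, ha1⟩, har⟩ := mem a ha
  obtain ⟨⟨hb0, hb1⟩, hbr⟩ := mem b hb
  obtain ⟨⟨hc0, hc1⟩, hcr⟩ := mem c hc
  rcases hab.lt_or_gt with hab | hba
  · rcases hbc.lt_or_gt with hbc | hcb
    · exact unit_six_concordant_no_three' _ _ _ _ _ h0 h4 ha0 hab hbc hc1 har hbr hcr
    · rcases hac.lt_or_gt with hac | hca
      · exact unit_six_concordant_no_three' _ _ _ _ _ h0 h4 ha0 hac hcb hb1 har hcr hbr
      · exact unit_six_concordant_no_three' _ _ _ _ _ h0 h4 hc0 hca hab hb1 hcr har hbr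
  · rcases hbc.lt_or_gt with hbc | hcb
    · rcases hac.lt_or_gt with hac | hca
      · exact unit_six_concordant_no_three' _ _ _ _ _ h0 h4 hb0 hba hac hc1 hbr har hcr
      · exact unit_six_concordant_no_three' _ _ _ _ _ h0 h4 hb0 hbc hca ha1 hbr hcr har
    · exact unit_six_concordant_no_three' _ _ _ _ _ h0 h4 hc0 hcb hba ha1 hcr hbr har

end StaticTridiagonalRealUnit
end Summit.ValiantsHypothesis.ValiantsHypothesis.Theorems.KPlusLogSqLaw
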